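import Summits.AnomalousDissipation.AnomalousDissipation.Theorems.SolenoidalFractalHomogenisationLagrangianStepVmodCorrectedGeneratorL2
import Summits.AnomalousDissipation.AnomalousDissipation.Theorems.SolenoidalFractalHomogenisationLagrangianStepVmodInverseFrameBounds
import Summits.AnomalousDissipation.AnomalousDissipation.Theorems.SolenoidalFractalHomogenisationLagrangianStepVmodInverseFrameDeriv
import Summits.AnomalousDissipation.AnomalousDissipation.Theorems.SolenoidalFractalHomogenisationLagrangianStepVmodDistortedCorrectedTest
import Summits.AnomalousDissipation.AnomalousDissipation.Theorems.SolenoidalFractalHomogenisationLagrangianStepVmodDistortedWeakIntegrand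
import HarnessLib

/-!
# K1L_D (stmt-AnomalousDissipation-27980), (ℓ3-A) road A, (S1d): the `hN` of (D-GEN-J) DISCHARGED along the frame class —
# `‖J'•ζ₀ + (b·∇)(J•ζ₀) + 𝓛^{G,*}_{𝔸'}(J•ζ₀)‖_{L²} ≤ N(θ, Tw, n_C, |𝔸'|, ‖b‖_∞; ‖ζ₀‖₂, ‖∂ζ₀‖₂, ‖∂²ζ₀‖₂)` for a.e. `τ ∈ (0,Tw)`
(helper; `--supports 27980 --as helper`; prover ad-k1loc-p3 g11; RULING D28-18 (5).)

Constants of the frame class at a window time (`IsFrameModulation` + `IsFrameRegular θ Tw nC G J`, `θ ≤ 1/18`, `0 < Tw`):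
`|G| ≤ 1 + θ` (`near_one`), `|∂G| ≤ θ·n_C` (`grad_le`), `|J| ≤ 2` (p726173), `|∂J| ≤ 2θ·n_C`, `|∂²J| ≤ 2θ·n_C²` (`derivBound`),
`|G'| ≤ θ/Tw` (`rate` + `HasDerivAt.le_of_lip'`), `|J'| ≤ 9·(2·(θ/Tw)·2)` (`J' = −J G′ J`, p726275).
* §1 these constants; * §2 measurability of the generator slice (`J'•ζ₀` as an a.e. limit of difference quotients of continuous fields;
  `(b·∇)Ψ`, `𝓛^{G,*}Ψ` from continuity / `measurable_uncurry_partialDeriv_of_continuous`);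
* §3 **`IsFrameRegular.hN_correctedTest`** — the `hN` hypothesis of `IsDistortedPropagator.abs_inner_sub_inner_le_of_correctedTest` (p724081) with the
  explicit `N` of (S1b)/(S1c) at `C = 1+θ, B = θn_C, C₀ = 2, C₁ = 2θn_C, C₂ = 2θn_C², CJ' = 36θ/Tw`.
`sorry`-free; NOT a proof of any block, of K1L_D or of AD; rung F-D1.A0.
-/

set_option linter.dupNamespace false

noncomputable section

namespace Summit.AnomalousDissipation.AnomalousDissipation.Theorems.SolenoidalFractalHomogenisation.LagrangianStep.VmodDist

open Literature.Analysis Literature.Analysis.FluidPDE Literature.Analysis.FunctionSpaces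
open MeasureTheory Set Filter Function
open scoped ENNReal Topology
open Summit.AnomalousDissipation.AnomalousDissipation.Theorems.SolenoidalFractalHomogenisation.LagrangianStep.CellClauseMod

variable {θ Tw nC : ℝ} {G J : ℝ → UnitAddTorus (Fin 3) → Matrix (Fin 3) (Fin 3) ℝ}

/-! ## §1 Constants of the frame class at a window time -/

/-- `0 ≤ θ` for a frame modulation on a nonempty window. -/
theorem theta_nonneg_of_isFrameModulation (hG : IsFrameModulation θ Tw nC G) (hTw : 0 ≤ Tw) : 0 ≤ θ :=
  le_trans (abs_nonneg _) (hG.near_one 0 ⟨le_rfl, hTw⟩ 0 0 0)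

/-- `|G t y i j| ≤ 1 + θ` on the window. -/
theorem abs_frame_entry_le (hG : IsFrameModulation θ Tw nC G) {t : ℝ} (ht : t ∈ Icc 0 Tw) (y : UnitAddTorus (Fin 3)) (i j : Fin 3) :
    |G t y i j| ≤ 1 + θ := by
  have h := hG.near_one t ht y i j
  have h1 : |(1 : Matrix (Fin 3) (Fin 3) ℝ) i j| ≤ 1 := by
    rw [Matrix.one_apply]; split_ifs <;> simp
  calc |G t y i j| = |(G t y i j - (1 : Matrix (Fin 3) (Fin 3) ℝ) i j) + (1 : Matrix (Fin 3) (Fin 3) ℝ) i j| := by rw [sub_add_cancel]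
    _ ≤ |G t y i j - (1 : Matrix (Fin 3) (Fin 3) ℝ) i j| + |(1 : Matrix (Fin 3) (Fin 3) ℝ) i j| := abs_add_le _ _
    _ ≤ 1 + θ := by linarith

/-- **`|G'| ≤ θ/Tw`**: the pointwise rate bounds any time derivative of an entry inside the window. -/
theorem abs_frame_deriv_entry_le (hG : IsFrameModulation θ Tw nC G) (hTw : 0 < Tw) {t : ℝ} (ht : t ∈ Ioo 0 Tw)
    {y : UnitAddTorus (Fin 3)} {G't : Matrix (Fin 3) (Fin 3) ℝ} (hd : HasDerivAt (fun s => G s y) G't t) (i j : Fin 3) :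
    |G't i j| ≤ θ / Tw := by
  have hθ0 : 0 ≤ θ := theta_nonneg_of_isFrameModulation hG hTw.le
  have hde : HasDerivAt (fun s => G s y i j) (G't i j) t := (hasDerivAt_pi.1 ((hasDerivAt_pi.1 hd) i)) j
  have hlip : ∀ᶠ s in 𝓝 t, ‖G s y i j - G t y i j‖ ≤ θ / Tw * ‖s - t‖ := by
    filter_upwards [Icc_mem_nhds ht.1 ht.2] with s hs
    rw [Real.norm_eq_abs, Real.norm_eq_abs]
    exact hG.rate y i j t (Ioo_subset_Icc_self ht) s hs
  have h := hde.le_of_lip' (div_nonneg hθ0 hTw.le) hlip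
  rwa [Real.norm_eq_abs] at h

/-- `|∂_c J| ≤ 2θ·n_C` on the window (`derivBound`, word `[c]`). -/
theorem IsFrameRegular.abs_partialDeriv_inv_le (hR : IsFrameRegular θ Tw nC G J) {t : ℝ} (ht : t ∈ Icc 0 Tw) (y : UnitAddTorus (Fin 3))
    (a m c : Fin 3) : |Torus.partialDeriv c (fun y => J t y a m) y| ≤ 2 * θ * nC := by
  have h := (hR.derivBound t ht y a m [c] (by simp) (by simp)).2
  simpa using h

/-- `|∂_e∂_c J| ≤ 2θ·n_C²` on the window (`derivBound`, word `[e, c]`). -/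
theorem IsFrameRegular.abs_partialDeriv₂_inv_le (hR : IsFrameRegular θ Tw nC G J) {t : ℝ} (ht : t ∈ Icc 0 Tw) (y : UnitAddTorus (Fin 3))
    (a m c e : Fin 3) : |Torus.partialDeriv e (Torus.partialDeriv c (fun y => J t y a m)) y| ≤ 2 * θ * nC ^ 2 := by
  have h := (hR.derivBound t ht y a m [e, c] (by simp) (by simp)).2
  simpa using h

/-- **`|J'| ≤ 9·(2·(θ/Tw)·2)`** at a window time where `J` and `G` are differentiable in time (`J' = −J G' J`, `|J| ≤ 2`, `|G'| ≤ θ/Tw`). -/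
theorem IsFrameRegular.abs_deriv_inv_entry_le (hR : IsFrameRegular θ Tw nC G J) (hG : IsFrameModulation θ Tw nC G) (hθ : θ ≤ 1 / 18)
    (hTw : 0 < Tw) {t : ℝ} (ht : t ∈ Ioo 0 Tw) {y : UnitAddTorus (Fin 3)} {J't G't : Matrix (Fin 3) (Fin 3) ℝ}
    (hJ' : HasDerivAt (fun s => J s y) J't t) (hG' : HasDerivAt (fun s => G s y) G't t) (a c : Fin 3) :
    |J't a c| ≤ 9 * (2 * (θ / Tw) * 2) := by
  have hθ0 : 0 ≤ θ := theta_nonneg_of_isFrameModulation hG hTw.le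
  have h := abs_inverse_deriv_entry_le (G := fun s => G s y) (J := fun s => J s y) (G' := fun _ => G't) (J' := fun _ => J't) (t := t)
    (fun s => hR.mul_eq_one s y) hG' hJ' (CJ := 2) (B' := θ / Tw) (by norm_num) (div_nonneg hθ0 hTw.le)
    (fun a c => hR.abs_inverse_entry_le_two hG hθ (Ioo_subset_Icc_self ht) y a c) (fun a c => abs_frame_deriv_entry_le hG hTw ht hG' a c) a c
  simpa using h

/-! ## §2 Measurability of the generator slice -/

variable {ζ₀ : VF}

/-- **`J'(t)•ζ₀` is a.e.-strongly measurable**: it is the pointwise limit of the difference quotients `h⁻¹((J(t+h) − J(t))•ζ₀)`, continuous fields. -/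
theorem aestronglyMeasurable_distort_deriv (hJs : ∀ s a c, Torus.IsSmooth (fun y => J s y a c)) (hζs : Torus.IsSmooth ζ₀)
    {t : ℝ} {J't : UnitAddTorus (Fin 3) → Matrix (Fin 3) (Fin 3) ℝ} (hJ' : ∀ y, HasDerivAt (fun s => J s y) (J't y) t) :
    AEStronglyMeasurable (Torus.distort J't ζ₀) volume := by
  set u : ℕ → ℝ := fun n => 1 / ((n : ℝ) + 1) with hu
  have hu0 : Tendsto u atTop (𝓝[>] 0) :=
    tendsto_nhdsWithin_iff.2 ⟨tendsto_one_div_add_atTop_nhds_zero_nat,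
      Eventually.of_forall fun n => by simp only [hu, mem_Ioi]; positivity⟩
  refine aestronglyMeasurable_of_tendsto_ae atTop
    (f := fun n x => (u n)⁻¹ • (Torus.distort (J (t + u n)) ζ₀ x - Torus.distort (J t) ζ₀ x)) (fun n => ?_) (Eventually.of_forall fun x => ?_)
  · exact (((Torus.isSmooth_distort (hJs _) hζs).continuous.sub (Torus.isSmooth_distort (hJs _) hζs).continuous).const_smul ((u n)⁻¹ : ℝ)).aestronglyMeasurable
  · have hd : HasDerivAt (fun s => Torus.distort (J s) ζ₀ x) (Torus.distort J't ζ₀ x) t :=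
      correctedTest_hasDerivAt (J := J) (J' := fun _ => J't) (t := t) hJ' x
    exact hd.tendsto_slope_zero_right.comp hu0

/-- The convective slice `(b₀·∇)Ψ` is a.e.-strongly measurable for measurable `b₀` and smooth `Ψ`. -/
theorem aestronglyMeasurable_convect {b₀ Ψ : VF} (hbm : AEStronglyMeasurable b₀ volume) (hΨ : Torus.IsSmooth Ψ) :
    AEStronglyMeasurable (Torus.convect b₀ Ψ) volume := by
  have e : Torus.convect b₀ Ψ = fun x => ∑ i, b₀ x i • Torus.partialDeriv i Ψ x := by
    funext x; exact Torus.convect_eq_sum_smul_partialDeriv (hΨ.isContDiff (by simp)) x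
  rw [e]
  refine Finset.aestronglyMeasurable_fun_sum _ fun i _ => ?_
  exact ((PiLp.continuous_apply 2 (fun _ : Fin 3 => ℝ) i).comp_aestronglyMeasurable hbm).smul
    (hΨ.partialDeriv i).continuous.aestronglyMeasurable

/-- The distorted adjoint viscous slice `𝓛^{G,*}_{𝔹₀}Ψ` is a.e.-strongly measurable for continuous `G`-entries and smooth `Ψ`. -/
theorem aestronglyMeasurable_viscAdjVar {Gs : UnitAddTorus (Fin 3) → Matrix (Fin 3) (Fin 3) ℝ} (hGc : ∀ i j, Continuous (fun y => Gs y i j))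
    (𝔹₀ : Torus.Visc4 (Fin 3)) {Ψ : VF} (hΨ : Torus.IsSmooth Ψ) :
    AEStronglyMeasurable (Torus.viscAdjVar (fun y => Torus.Visc4.conj (Gs y) 𝔹₀) Ψ) volume := by
  -- each scalar summand `∂_e(𝔹 icle · (∂_cΨ)_i)` is measurable (derivative of a continuous function)
  have hterm : ∀ i c l e, Measurable fun x => Torus.partialDeriv e (fun y => Torus.Visc4.conj (Gs y) 𝔹₀ i c l e * (Torus.partialDeriv c Ψ y) i) x := by
    intro i c l e
    have hg : Continuous (uncurry fun (_ : ℝ) y => Torus.Visc4.conj (Gs y) 𝔹₀ i c l e * (Torus.partialDeriv c Ψ y) i) := by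
      have h1 : Continuous (uncurry fun (_ : ℝ) y => Torus.Visc4.conj (Gs y) 𝔹₀ i c l e) :=
        Torus.continuous_uncurry_conj_entry (G := fun _ => Gs) (fun i j => (hGc i j).comp continuous_snd) 𝔹₀ i c l e
      have h2 : Continuous (uncurry fun (_ : ℝ) y => (Torus.partialDeriv c Ψ y) i) :=
        ((PiLp.continuous_apply 2 (fun _ : Fin 3 => ℝ) i).comp (hΨ.partialDeriv c).continuous).comp continuous_snd
      exact h1.mul h2
    have hm : Measurable ((uncurry fun (_ : ℝ) x => Torus.partialDeriv e (fun y => Torus.Visc4.conj (Gs y) 𝔹₀ i c l e * (Torus.partialDeriv c Ψ y) i) x)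
        ∘ (Prod.mk (0 : ℝ))) := (measurable_uncurry_partialDeriv_of_continuous hg e).comp measurable_prodMk_left
    exact hm
  have e2 : Torus.viscAdjVar (fun y => Torus.Visc4.conj (Gs y) 𝔹₀) Ψ = fun x =>
      ∑ j, (∑ i, ∑ c, ∑ e, Torus.partialDeriv e (fun y => Torus.Visc4.conj (Gs y) 𝔹₀ i c j e * (Torus.partialDeriv c Ψ y) i) x) •
        EuclideanSpace.single j (1 : ℝ) := by
    funext x; rfl
  rw [e2]
  refine (Finset.measurable_sum _ fun j _ => ?_).aestronglyMeasurable
  exact (Finset.measurable_sum _ fun i _ => Finset.measurable_sum _ fun c _ => Finset.measurable_sum _ fun e _ => hterm i c j e).smul_const _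

/-- The whole generator slice is a.e.-strongly measurable. -/
theorem aestronglyMeasurable_correctedGenerator (hJs : ∀ s a c, Torus.IsSmooth (fun y => J s y a c)) (hζs : Torus.IsSmooth ζ₀)
    {t : ℝ} {J't : UnitAddTorus (Fin 3) → Matrix (Fin 3) (Fin 3) ℝ} (hJ' : ∀ y, HasDerivAt (fun s => J s y) (J't y) t)
    {Gs : UnitAddTorus (Fin 3) → Matrix (Fin 3) (Fin 3) ℝ} (hGc : ∀ i j, Continuous (fun y => Gs y i j)) (𝔹₀ : Torus.Visc4 (Fin 3))
    {b₀ : VF} (hbm : AEStronglyMeasurable b₀ volume) :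
    AEStronglyMeasurable (fun x => Torus.distort J't ζ₀ x + Torus.convect b₀ (Torus.distort (J t) ζ₀) x
      + Torus.viscAdjVar (fun y => Torus.Visc4.conj (Gs y) 𝔹₀) (Torus.distort (J t) ζ₀) x) volume :=
  ((aestronglyMeasurable_distort_deriv hJs hζs hJ').add (aestronglyMeasurable_convect hbm (Torus.isSmooth_distort (hJs t) hζs))).add
    (aestronglyMeasurable_viscAdjVar hGc 𝔹₀ (Torus.isSmooth_distort (hJs t) hζs))

/-! ## §3 The `hN` of (D-GEN-J) along the frame class -/

/-- **(S1d) `hN` discharged.**  Along a frame-regular pair `(G,J)` (`θ ≤ 1/18`, `0 < Tw`, `0 ≤ n_C`), for a measurable carrier with `‖b‖ ≤ Bb` on the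
window, a smooth steady test `ζ₀` and ANY a.e. time derivative `J'` of `J` (the one fed to p724081): for a.e. `τ ∈ (0,Tw)` the generator slice
`J'(τ)•ζ₀ + (b(τ)·∇)(J(τ)•ζ₀) + 𝓛^{G(τ),*}_{𝔸'}(J(τ)•ζ₀)` is in `L²` with norm at most the explicit `N` below — (S1b)+(S1c) at
`C = 1+θ, B = θn_C, |𝔸'| ≤ A, C₀ = 2, C₁ = 2θn_C, C₂ = 2θn_C², CJ' = 9(2(θ/Tw)2)`, in the L²-currency of `ζ₀`. -/
theorem IsFrameRegular.hN_correctedTest (hR : IsFrameRegular θ Tw nC G J) (hG : IsFrameModulation θ Tw nC G) (hθ : θ ≤ 1 / 18)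
    (hTw : 0 < Tw) (hnC : 0 ≤ nC) (𝔸' : Torus.Visc4 (Fin 3)) {A : ℝ} (hA0 : 0 ≤ A) (hA : ∀ i a j b', |𝔸' i a j b'| ≤ A)
    {b : ℝ → VF} (hbm : ∀ τ, AEStronglyMeasurable (b τ) volume) {Bb : ℝ} (hBb0 : 0 ≤ Bb) (hBb : ∀ τ ∈ Ioo 0 Tw, ∀ y, ‖b τ y‖ ≤ Bb)
    (hζs : Torus.IsSmooth ζ₀) {J' : ℝ → UnitAddTorus (Fin 3) → Matrix (Fin 3) (Fin 3) ℝ}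
    (hJ' : ∀ᵐ t ∂(volume.restrict (Ioo 0 Tw)), ∀ y, HasDerivAt (fun s => J s y) (J' t y) t) :
    ∀ᵐ τ ∂(volume.restrict (Ioo 0 Tw)),
      MemLp (fun x => Torus.distort (J' τ) ζ₀ x + Torus.convect (b τ) (Torus.distort (J τ) ζ₀) x +
          Torus.viscAdjVar (fun y => Torus.Visc4.conj (G τ y) 𝔸') (Torus.distort (J τ) ζ₀) x) 2 volume ∧
      eLpNorm (fun x => Torus.distort (J' τ) ζ₀ x + Torus.convect (b τ) (Torus.distort (J τ) ζ₀) x +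
          Torus.viscAdjVar (fun y => Torus.Visc4.conj (G τ y) 𝔸') (Torus.distort (J τ) ζ₀) x) 2 volume
        ≤ ENNReal.ofReal
          ((9 * (9 * (2 * (θ / Tw) * 2)) + 27 * Bb * (2 * θ * nC)
              + 3 * (27 * ((1 + θ) * A * (1 + θ)) * (81 * (2 * θ * nC ^ 2))
                + 81 * ((1 + θ) * A * (θ * nC) + (θ * nC) * A * (1 + θ)) * (27 * (2 * θ * nC)))) * (eLpNorm ζ₀ 2 volume).toReal
          + (9 * Bb * 2 + 3 * (27 * ((1 + θ) * A * (1 + θ)) * (54 * (2 * θ * nC))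
                + 81 * ((1 + θ) * A * (θ * nC) + (θ * nC) * A * (1 + θ)) * (9 * 2)))
              * ∑ c, (eLpNorm (Torus.partialDeriv c ζ₀) 2 volume).toReal
          + (3 * (27 * ((1 + θ) * A * (1 + θ)) * (9 * 2))) * ∑ c, ∑ e, (eLpNorm (Torus.partialDeriv e (Torus.partialDeriv c ζ₀)) 2 volume).toReal) := by
  have hθ0 : 0 ≤ θ := theta_nonneg_of_isFrameModulation hG hTw.le
  obtain ⟨G', hG'⟩ := hR.aeDerivG
  filter_upwards [hJ', hG', ae_restrict_mem measurableSet_Ioo] with τ hJτ hGτ hτ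
  have hτ' : τ ∈ Icc 0 Tw := Ioo_subset_Icc_self hτ
  -- slice regularity
  have hG1 : ∀ i j, Torus.IsContDiff 1 (fun y => G τ y i j) := fun i j => (hG.smooth τ hτ' i j).isContDiff (by simp)
  have hGc : ∀ i j, Continuous (fun y => G τ y i j) := fun i j => (hG.smooth τ hτ' i j).continuous
  have hF := aestronglyMeasurable_correctedGenerator (ζ₀ := ζ₀) hR.smooth hζs hJτ hGc 𝔸' (hbm τ)
  exact memLp_and_eLpNorm_correctedGenerator_le (Gs := G τ) (Jt := J τ) (J't := J' τ) (b₀ := b τ) (ζ := ζ₀) hG1 (hR.smooth τ) hζs 𝔸' hF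
    (C := 1 + θ) (B := θ * nC) (A := A) (C₀ := 2) (C₁ := 2 * θ * nC) (C₂ := 2 * θ * nC ^ 2) (CJ' := 9 * (2 * (θ / Tw) * 2)) (Bb := Bb)
    (by linarith) (by positivity) hA0 (by norm_num) (by positivity) (by positivity) (by positivity) hBb0
    (fun y i j => abs_frame_entry_le hG hτ' y i j) (fun y i j e' => hG.grad_le τ hτ' y i j e') hA
    (fun y a m => hR.abs_inverse_entry_le_two hG hθ hτ' y a m) (fun y a m c => hR.abs_partialDeriv_inv_le hτ' y a m c)
    (fun y a m c e => hR.abs_partialDeriv₂_inv_le hτ' y a m c e)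
    (fun y a m => hR.abs_deriv_inv_entry_le hG hθ hTw hτ (hJτ y) (hGτ y) a m) (hBb τ hτ)

end Summit.AnomalousDissipation.AnomalousDissipation.Theorems.SolenoidalFractalHomogenisation.LagrangianStep.VmodDist

end
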